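/-
Copyright (c) 2026. All rights reserved.
Released under Apache 2.0 license as described in the file LICENSE.
Authors: abc-iut cell, prover seat abc-iut-L4-t5 (wave 2, gen 8), over abc-iut-w4-d095's `archGenuine` setting
(`LogFrobeniusLogWallArchOrigin.lean`) and abc-iut-L4-t14's geometric Aut-holomorphic field functor
(`ArchimedeanHolFieldFunctorGeometric.lean`).
-/
import Literature.AnabelianGeometry.AbsoluteAnabelian.LogFrobeniusNotSimCompatPlusOfObstruction
import Literature.AnabelianGeometry.AbsoluteAnabelian.ArchimedeanHolFieldFunctorGeometric
import HarnessLib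

/-!
# [AbsTopIII] Corollary 5.5 (iv) at the archimedean setting over GEOMETRIC Aut-holomorphic pairs: no object binder

S. Mochizuki, *Topics in absolute anabelian geometry III: global reconstruction algorithms*, J. Math. Sci. Univ.
Tokyo 22 (2015) 939–1156 [MochizukiAbsTopIII2015]; locators = pages of the author's manuscript
(`paper:url-5493eb38cbb7`), read on the page: Cor 5.5 (iv) p. 131, proof pp. 132–133; Def 4.1 (i)/(iii) pp. 101–103
(Aut-holomorphic `TF`-pairs `(𝕏 ↶ k)` over elliptically admissible Aut-holomorphic orbispaces).

PROOF-ONLY companion (no new notion, no named `Prop`).  The closers of Cor 5.5 (iv) at the setting with genuine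
archimedean components `archGenuine 𝔄 Vmod isArc` (abc-iut-w4-d095; both sentences for every `TS`-datum:
`archGenuine_cor55iv_all`, abc-iut-L4-t5) carry the binders {`𝔄` an Aut-holomorphic field functor, one archimedean
place `v₀`, one `TF`-pair `x₀`}.  Over abc-iut-L4-t14's GEOMETRIC field functor `HolRS.geometricAutHolFieldFunctor Q`
(`𝒜_𝕏 = ℂ` on a class `Q` of connected Riemann surfaces) the pair binder is discharged by the tautological pair
`(𝕏 ↶ ℂ)` (`HolRS.tfPair`), and with `Q = ⊤` by the complex plane: the archimedean counterpart of abc-iut-w4-d095's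
`nonarchGenuineSlim_cor55LogWall_and_notSimCompat` (object binder discharged at the slim mono-analytic carrier).
* `archGenuine_geometric_cor55iv_all` — binders {`Q`, `X ∈ Q`, `v₀` archimedean};
* `archGenuine_complexPlane_cor55iv_all` — binders {`v₀` archimedean} ONLY: `Cor55Incompatibility` and, for every
  `TS`-datum `T`, `Cor55LogWall T ∧ Cor55NotSimultaneouslyCompatible T`;
* `exists_setting_cor55iv_all` — existence form over every index set (universe `1`) with an archimedean place.
MODEL-LEVEL exactly as `archGenuine` (module docstring of `LogFrobeniusLogWallArchOrigin.lean`: archimedean components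
print's Def 5.4 (v) graph realised by Def 4.1 (iv) objects; nonarchimedean and mono-analytic rows placeholders, not
read by Cor 5.5 (iv) at an archimedean place).

Refereed pre-IUT material; OUR kernel check of typed statements; nothing here bears on [IUTchIII] Cor. 3.12; no side
taken; typed ≠ proved; model-level ≠ node-level.
-/

set_option autoImplicit false

open CategoryTheory

namespace Literature.AnabelianGeometry.AbsoluteAnabelian

namespace LogFrobeniusSetting

/-- **[AbsTopIII] Cor 5.5 (iv) — every typed sentence — at the archimedean setting over the GEOMETRIC Aut-holomorphic
field functor on a class `Q` of connected Riemann surfaces containing some `X`**, for every index set with an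
archimedean place `v₀`: `Cor55Incompatibility`, and `Cor55LogWall T ∧ Cor55NotSimultaneouslyCompatible T` for every
`TS`-datum `T`; the `TF`-pair binder of `archGenuine_cor55iv_all` is the tautological pair `(𝕏 ↶ ℂ)` over `X`.
MODEL-LEVEL. [cite: MochizukiAbsTopIII2015, Cor 5.5 (iv) p. 131] -/
theorem archGenuine_geometric_cor55iv_all (Q : ObjectProperty HolRS) (X : HolRS) (hX : Q X) (Vmod : Type 1)
    (isArc : Vmod → Bool) (v₀ : Vmod) (hv₀ : isArc v₀ = true) :
    (archGenuine (HolRS.geometricAutHolFieldFunctor Q) Vmod isArc).Cor55Incompatibility ∧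
      ∀ T : (archGenuine (HolRS.geometricAutHolFieldFunctor Q) Vmod isArc).TSHomotopies,
        (archGenuine (HolRS.geometricAutHolFieldFunctor Q) Vmod isArc).Cor55LogWall T ∧
          (archGenuine (HolRS.geometricAutHolFieldFunctor Q) Vmod isArc).Cor55NotSimultaneouslyCompatible T :=
  archGenuine_cor55iv_all (HolRS.geometricAutHolFieldFunctor Q) Vmod isArc v₀ hv₀ (ULift.up (HolRS.tfPair Q ⟨X, hX⟩))

/-- **[AbsTopIII] Cor 5.5 (iv) — every typed sentence — with NO object binder**: at the archimedean setting over the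
geometric Aut-holomorphic field functor on ALL connected Riemann surfaces, for every index set with an archimedean place
`v₀`, `Cor55Incompatibility` holds and, for every `TS`-datum `T`, `Cor55LogWall T ∧ Cor55NotSimultaneouslyCompatible T`
(the pair binder discharged by `(ℂ ↶ ℂ)`, the complex plane `HolRS.complexPlane`).  Binders: {`v₀` archimedean}.
MODEL-LEVEL. [cite: MochizukiAbsTopIII2015, Cor 5.5 (iv) p. 131] -/
theorem archGenuine_complexPlane_cor55iv_all (Vmod : Type 1) (isArc : Vmod → Bool) (v₀ : Vmod)
    (hv₀ : isArc v₀ = true) :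
    (archGenuine (HolRS.geometricAutHolFieldFunctor ⊤) Vmod isArc).Cor55Incompatibility ∧
      ∀ T : (archGenuine (HolRS.geometricAutHolFieldFunctor ⊤) Vmod isArc).TSHomotopies,
        (archGenuine (HolRS.geometricAutHolFieldFunctor ⊤) Vmod isArc).Cor55LogWall T ∧
          (archGenuine (HolRS.geometricAutHolFieldFunctor ⊤) Vmod isArc).Cor55NotSimultaneouslyCompatible T :=
  archGenuine_geometric_cor55iv_all ⊤ HolRS.complexPlane trivial Vmod isArc v₀ hv₀

/-- The same setting CARRIES a `TS`-datum (so «for every `TS`-datum» is not vacuous).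
[cite: MochizukiAbsTopIII2015, Def 5.4 (vii) p. 128] -/
theorem archGenuine_complexPlane_nonempty_tsHomotopies (Vmod : Type 1) (isArc : Vmod → Bool) :
    Nonempty (archGenuine (HolRS.geometricAutHolFieldFunctor ⊤) Vmod isArc).TSHomotopies :=
  ⟨archGenuineTS (HolRS.geometricAutHolFieldFunctor ⊤) Vmod isArc⟩

/-- Existence form with no data beyond the index set: over every index set (universe `1`) with an archimedean place
there is a global log-Frobenius setting carrying a `TS`-datum at which every typed sentence of [AbsTopIII] Cor 5.5 (iv)
holds — the `⊞`-only log-wall, and both print-faithful sentences for every `TS`-datum.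
[cite: MochizukiAbsTopIII2015, Cor 5.5 (iv) p. 131] -/
theorem exists_setting_cor55iv_all (Vmod : Type 1) (isArc : Vmod → Bool) (v₀ : Vmod) (hv₀ : isArc v₀ = true) :
    ∃ L : LogFrobeniusSetting Vmod isArc, Nonempty L.TSHomotopies ∧ L.Cor55Incompatibility ∧
      ∀ T : L.TSHomotopies, L.Cor55LogWall T ∧ L.Cor55NotSimultaneouslyCompatible T :=
  ⟨archGenuine (HolRS.geometricAutHolFieldFunctor ⊤) Vmod isArc,
    archGenuine_complexPlane_nonempty_tsHomotopies Vmod isArc,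
    archGenuine_complexPlane_cor55iv_all Vmod isArc v₀ hv₀⟩

end LogFrobeniusSetting

end Literature.AnabelianGeometry.AbsoluteAnabelian
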